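import Literature.Probability.RandomPlanarGeometry.BDGS2012CountBoundsProofs
import Mathlib.Topology.Order.LiminfLimsup
import HarnessLib

/-!
# The brick-wall weight family of the square-lattice self-avoiding walk

Topic `Literature/Probability/RandomPlanarGeometry`; definition request `defn-SAW.brickWallLaw`
(route `CriticalPhenomena/SAWScalingLimit/SAWBrickWallHomotopy`, items `BrickWallFlow`
= `stmt-CriticalPhenomena-5791` and `OddBondDensity` = `stmt-CriticalPhenomena-5792`, whose
signatures inline the notions below as `let`s; the bodies here are LITERALLY those terms, so the
items restate by unfolding — checked: `BrickWallFlow ↔ <restated with these defs>` is `Iff.rfl`).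

The **brick-wall lattice** is the spanning subgraph of `ℤ²` obtained by deleting the vertical
bond `{(x, y), (x, y+1)}` whenever `x + y` is odd; every site keeps its two horizontal bonds and
exactly one vertical bond, and the resulting 3-regular graph is the honeycomb lattice `ℍ` drawn
with rectangular bricks (a standard presentation of `ℍ`). Giving the deleted ("odd vertical")
bonds a weight `t ∈ [0, 1]` instead of removing them interpolates ON ONE GRAPH between the
honeycomb SAW (`t = 0`: a walk has positive weight iff it uses no odd vertical bond, i.e. iff it
is a brick-wall = honeycomb walk) and the uniform square-lattice SAW (`t = 1`). This is a
two-parameter (bond-type-weighted) self-avoiding walk in the sense of anisotropic SAW models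
(direction-dependent step fugacities and their critical curve: Borgs–Chayes–King–Madras,
*Anisotropic self-avoiding walks*, J. Math. Phys. 41 (2000) 1240–1279, §1), here with the
weight on a period-2 sublattice of vertical bonds; its critical fugacity `x_c(t)` is the inverse
exponential growth rate of the weighted counts (Madras–Slade 1993, §1.2, for `t = 1`;
Duminil-Copin–Smirnov 2012, §1 and Theorem 1, for the honeycomb value `1/√(2+√2)`).

## Contents (namespace `Literature.Probability.RandomPlanarGeometry.SAW`)

* `oddVerticalCount p = N_odd(p)` — the number of darts of a lattice walk `p` (any graph on
  `Site 2 = ℤ²`) that traverse a vertical bond `{(x, y), (x, y+1)}` with `x + y` odd, in either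
  direction (`List.countP` over `p.darts`, exactly the route's `nodd`);
* `weightedCount t n = Z_n(t) = Σ_{ω n-step SAW of ℤ² from 0} t^{N_odd(ω)}` (same finsets as
  `count`: endpoints in `box 2 n`, `finsetWalkLength n 0 v` filtered by `IsPath`);
* `criticalFugacityT t = x_c(t) = (limsup_n Z_n(t)^{1/n})⁻¹`;
* `brickWallWeight Ω δ t a b` — the measure `γ ↦ x_c(t)^{|γ|} t^{N_odd(γ)}` on
  `DomainSAW Ω δ a b` (SAWs of `Ω_δ ⊆ δℤ²` from `a` to `b`), and its normalisation
  **`brickWallLaw Ω δ t a b = P^t_{(Ω,δ)}`** (junk `0` when the total weight is `0` or `∞`, as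
  for `SAW.law`).

API (all proved): `oddVerticalCount_nil/_cons/_le_length/_reverse`,
`oddVerticalCount_eq_zero_of_support` (horizontal walks use no vertical bond);
`weightedCount_one : Z_n(1) = cₙ`, `weightedCount_zero` (`Z_n(0)` counts the SAWs with
`N_odd = 0`, the brick-wall walks), `weightedCount_nonneg/_mono/_le_count`, `one_le_weightedCount`
(the straight walk), `count_le_four_pow`; `criticalFugacityT_one : x_c(1) = x_c`
(unconditional, via `tendsto_count_rpow_holds`), `criticalFugacityT_mem_Icc : x_c(t) ∈ [1/4, 1]`
and `criticalFugacityT_pos` for `t ∈ [0, 1]`, `criticalFugacityT_antitoneOn` on `[0, 1]`;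
`brickWallWeight_singleton`, `brickWallWeight_one : brickWallWeight Ω δ 1 a b = weight Ω δ a b`,
**`brickWallLaw_one : brickWallLaw Ω δ 1 a b = law Ω δ a b`**, `isProbabilityMeasure_brickWallLaw`
(total weight `≠ 0, ∞`), `brickWallWeight_univ_ne_zero` (a SAW exists, `t > 0`, `x_c(t) > 0`),
`brickWallWeight_univ_lt_top` (finitely many SAWs), `isProbabilityMeasure_brickWallLaw_of_finite`.

## What is NOT here

* `x_c(0) = hexCriticalFugacity = 1/√(2+√2)`: by `weightedCount_zero`, `Z_n(0)` is the number of
  `n`-step brick-wall walks from `0`, and the brick wall is graph-isomorphic to `hexGraph`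
  (`TriangularLattice.lean`), so this follows from `DuminilCopinSmirnov2012_thm1_holds`
  (`HexSAWTheorem1.lean`) once the isomorphism `brick wall ≃g hexGraph` and the transport of
  `sawCount` along it are in the tree; neither is, and no named fact is minted for it (D-0026).
* Regularity / strict monotonicity of `t ↦ x_c(t)` (BCKM-type arguments), existence of the limit
  `Z_n(t)^{1/n}` for `0 < t < 1` (the staggered weight is not obviously submultiplicative under
  concatenation, since translating by an odd vector swaps the two bond classes; hence `limsup`).

## References

* H. Duminil-Copin, S. Smirnov, *The connective constant of the honeycomb lattice equals
  `√(2+√2)`*, Ann. of Math. 175 (2012) 1653–1665, §1 and Theorem 1.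
* N. Madras, G. Slade, *The Self-Avoiding Walk*, Birkhäuser (1993), §1.2.
* C. Borgs, J. T. Chayes, C. King, N. Madras, *Anisotropic self-avoiding walks*, J. Math. Phys.
  41 (2000) 1240–1279 (doi:10.1063/1.533189), §1.
-/

noncomputable section

open MeasureTheory Filter Topology Literature.Probability.LatticeModels Literature.Probability.Percolation
open scoped NNReal ENNReal BigOperators

namespace Literature.Probability.RandomPlanarGeometry.SAW

/-! ### Odd vertical bonds used by a lattice walk -/

/-- `N_odd(p)`: the number of steps (darts) of the lattice walk `p` — a walk of any graph on
`ℤ² = Site 2`, e.g. `zdGraph 2` or a discrete domain graph `discreteDomainGraph Ω δ` — that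
traverse, in either direction, a vertical bond `{(x, y), (x, y+1)}` with `x + y` odd (the bonds
deleted from `ℤ²` to obtain the brick-wall presentation of the honeycomb lattice): the dart
`((x, y), (x', y'))` counts iff `x = x'` and `x + min(y, y')` is odd. Literally the term `nodd`
of route items `BrickWallFlow` / `OddBondDensity`. [folklore] -/
def oddVerticalCount {G : SimpleGraph (Site 2)} {u v : Site 2} (p : G.Walk u v) : ℕ :=
  p.darts.countP (fun d => decide (d.toProd.1 0 = d.toProd.2 0 ∧
    (d.toProd.1 0 + min (d.toProd.1 1) (d.toProd.2 1)) % 2 = 1))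

section OddVertical

variable {G : SimpleGraph (Site 2)}

/-- The trivial walk uses no bond. [folklore] -/
@[simp] theorem oddVerticalCount_nil (u : Site 2) :
    oddVerticalCount (SimpleGraph.Walk.nil : G.Walk u u) = 0 := rfl

/-- Prepending a step adds one iff the step is an odd vertical bond. [folklore] -/
theorem oddVerticalCount_cons {u v w : Site 2} (h : G.Adj u v) (p : G.Walk v w) :
    oddVerticalCount (SimpleGraph.Walk.cons h p) =
      oddVerticalCount p + (if u 0 = v 0 ∧ (u 0 + min (u 1) (v 1)) % 2 = 1 then 1 else 0) := by
  unfold oddVerticalCount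
  rw [SimpleGraph.Walk.darts_cons, List.countP_cons]
  simp only [decide_eq_true_eq]

/-- `N_odd(p) ≤ |p|`. [folklore] -/
theorem oddVerticalCount_le_length {u v : Site 2} (p : G.Walk u v) :
    oddVerticalCount p ≤ p.length := by
  unfold oddVerticalCount
  exact List.countP_le_length.trans_eq p.length_darts

/-- The counting predicate is symmetric under reversing a dart. [folklore] -/
theorem oddVertical_pred_symm (d : G.Dart) :
    decide (d.symm.toProd.1 0 = d.symm.toProd.2 0 ∧
        (d.symm.toProd.1 0 + min (d.symm.toProd.1 1) (d.symm.toProd.2 1)) % 2 = 1) =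
      decide (d.toProd.1 0 = d.toProd.2 0 ∧
        (d.toProd.1 0 + min (d.toProd.1 1) (d.toProd.2 1)) % 2 = 1) := by
  obtain ⟨⟨a, b⟩, hab⟩ := d
  simp only [SimpleGraph.Dart.symm, Prod.swap, min_comm (b 1) (a 1)]
  by_cases h : a 0 = b 0
  · simp [h]
  · simp [h, Ne.symm h]

/-- `N_odd` is invariant under reversal of the walk (the bonds are unoriented). [folklore] -/
theorem oddVerticalCount_reverse {u v : Site 2} (p : G.Walk u v) :
    oddVerticalCount p.reverse = oddVerticalCount p := by
  unfold oddVerticalCount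
  rw [SimpleGraph.Walk.darts_reverse, List.countP_reverse, List.countP_map]
  congr 1
  funext d
  exact oddVertical_pred_symm d

/-- A walk all of whose vertices have the same ordinate uses no vertical bond, so `N_odd = 0`
(e.g. the straight walk along the first axis). [folklore] -/
theorem oddVerticalCount_eq_zero_of_support {u v : Site 2} (p : G.Walk u v)
    (h : ∀ w ∈ p.support, w 1 = u 1) : oddVerticalCount p = 0 := by
  unfold oddVerticalCount
  rw [List.countP_eq_zero]
  intro d hd
  have h1 : d.toProd.1 1 = d.toProd.2 1 := by
    rw [h _ (p.dart_fst_mem_support_of_mem_darts hd), h _ (p.dart_snd_mem_support_of_mem_darts hd)]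
  have hne : d.toProd.1 ≠ d.toProd.2 := d.adj.ne
  simp only [decide_eq_true_eq, not_and]
  intro h0 _
  have key : ∀ i : Fin 2, d.toProd.1 i = d.toProd.2 i := by
    intro i
    fin_cases i
    exacts [h0, h1]
  exact hne (funext key)

end OddVertical

/-! ### The `t`-weighted counts `Z_n(t)` and the critical fugacity `x_c(t)` -/

open Classical in
/-- `Z_n(t) = Σ_ω t^{N_odd(ω)}`, the sum over the `n`-step self-avoiding walks `ω` of `ℤ²` from
`0` (the walks counted by `count n`: endpoints `v ∈ box 2 n`, length-`n` walks `0 → v` of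
`zdGraph 2` that are paths) of `t` to the number of odd vertical bonds used. `Z_n(1) = cₙ`
(`weightedCount_one`); `Z_n(0)` = the number of `n`-step brick-wall (= honeycomb) walks
(`weightedCount_zero`). Literally the inner term of `xc` in route item `BrickWallFlow`.
[folklore] -/
def weightedCount (t : ℝ) (n : ℕ) : ℝ :=
  ∑ v ∈ box 2 n, ∑ p ∈ ((zdGraph 2).finsetWalkLength n (0 : Site 2) v).filter (fun p => p.IsPath),
    t ^ (oddVerticalCount p)

/-- `x_c(t) := (limsup_n Z_n(t)^{1/n})⁻¹`, the critical fugacity of the `t`-weighted square-lattice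
SAW (inverse exponential growth rate of `Z_n(t)`; `limsup` because the staggered weight is not
literally submultiplicative). `x_c(1) = x_c = 1/μ(ℤ²)` (`criticalFugacityT_one`); `x_c(0)` is the
inverse growth rate of brick-wall = honeycomb walks, `= 1/√(2+√2)` by Duminil-Copin–Smirnov's
Theorem 1 modulo the isomorphism brick wall ≅ `hexGraph` (not in the tree). Literally the term
`xc` of route item `BrickWallFlow`. [folklore] -/
def criticalFugacityT (t : ℝ) : ℝ :=
  (Filter.limsup (fun n : ℕ => (weightedCount t n) ^ (1 / (n : ℝ))) Filter.atTop)⁻¹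

section Counts

/-- `Z_n(1) = cₙ`. [folklore] -/
theorem weightedCount_one (n : ℕ) : weightedCount 1 n = count n := by
  classical
  rw [weightedCount, count, Nat.cast_sum]
  refine Finset.sum_congr rfl fun v _ => ?_
  simp only [one_pow, Finset.sum_const, nsmul_eq_mul, mul_one]

/-- `Z_n(0)` is the number of `n`-step self-avoiding walks from `0` using no odd vertical bond,
i.e. of `n`-step self-avoiding walks of the brick-wall lattice (`0 ^ 0 = 1`, `0 ^ (k+1) = 0`).
[folklore] -/
theorem weightedCount_zero (n : ℕ) : weightedCount 0 n =
    ∑ v ∈ box 2 n, ((((zdGraph 2).finsetWalkLength n (0 : Site 2) v).filter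
      fun p => p.IsPath).filter fun p => oddVerticalCount p = 0).card := by
  classical
  rw [weightedCount, Nat.cast_sum]
  refine Finset.sum_congr rfl fun v _ => ?_
  rw [Finset.card_filter, Nat.cast_sum]
  refine Finset.sum_congr rfl fun p _ => ?_
  rw [zero_pow_eq]
  split_ifs <;> simp

/-- `Z_n(t) ≥ 0` for `t ≥ 0`. [folklore] -/
theorem weightedCount_nonneg {t : ℝ} (ht : 0 ≤ t) (n : ℕ) : 0 ≤ weightedCount t n :=
  Finset.sum_nonneg fun _ _ => Finset.sum_nonneg fun _ _ => pow_nonneg ht _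

/-- `Z_n` is monotone in `t ≥ 0`. [folklore] -/
theorem weightedCount_mono {s t : ℝ} (hs : 0 ≤ s) (hst : s ≤ t) (n : ℕ) :
    weightedCount s n ≤ weightedCount t n :=
  Finset.sum_le_sum fun _ _ => Finset.sum_le_sum fun _ _ => pow_le_pow_left₀ hs hst _

/-- `Z_n(t) ≤ cₙ` for `t ∈ [0, 1]`. [folklore] -/
theorem weightedCount_le_count {t : ℝ} (ht0 : 0 ≤ t) (ht1 : t ≤ 1) (n : ℕ) :
    weightedCount t n ≤ count n := by
  rw [← weightedCount_one]
  exact weightedCount_mono ht0 ht1 n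

/-- `Z_n(t) ≥ 1` for `t ≥ 0`: the straight walk `0 → e₀ → 2e₀ → ⋯ → n e₀` is self-avoiding and
uses no vertical bond (`t ^ 0 = 1`). [folklore] -/
theorem one_le_weightedCount {t : ℝ} (ht : 0 ≤ t) (n : ℕ) : 1 ≤ weightedCount t n := by
  classical
  have hmem := Zd.straightWalk_mem_saws 2 n
  rw [Zd.saws, Finset.mem_biUnion] at hmem
  obtain ⟨x, hx, hωx⟩ := hmem
  rw [Zd.sawFun, Finset.mem_image] at hωx
  obtain ⟨p, hp, hpω⟩ := hωx
  have hN : oddVerticalCount p = 0 := by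
    refine oddVerticalCount_eq_zero_of_support p fun w hw => ?_
    obtain ⟨i, rfl, -⟩ := SimpleGraph.Walk.mem_support_iff_exists_getVert.1 hw
    rw [hpω]
    simp [Zd.straightWalk]
  calc (1 : ℝ) = t ^ oddVerticalCount p := by rw [hN, pow_zero]
    _ ≤ ∑ q ∈ ((zdGraph 2).finsetWalkLength n (0 : Site 2) x).filter (fun q => q.IsPath),
          t ^ oddVerticalCount q :=
        Finset.single_le_sum (fun q _ => pow_nonneg ht _) hp
    _ ≤ weightedCount t n :=
        Finset.single_le_sum (f := fun v => ∑ q ∈ ((zdGraph 2).finsetWalkLength n (0 : Site 2)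
          v).filter (fun q => q.IsPath), t ^ oddVerticalCount q)
          (fun v _ => Finset.sum_nonneg fun _ _ => pow_nonneg ht _) hx

/-- `cₙ ≤ 4ⁿ` on `ℤ²` (from `cₙ ≤ 4 · 3ⁿ⁻¹`, `Zd.count_succ_le`). [folklore] -/
theorem count_le_four_pow (n : ℕ) : count n ≤ 4 ^ n := by
  cases n with
  | zero => simp [count_zero]
  | succ n =>
    have h : count (n + 1) ≤ 2 * 2 * (2 * 2 - 1) ^ n := Zd.count_succ_le 2 n
    calc count (n + 1) ≤ 2 * 2 * (2 * 2 - 1) ^ n := h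
      _ ≤ 4 * 4 ^ n := by
          norm_num
          exact Nat.pow_le_pow_left (by norm_num) n
      _ = 4 ^ (n + 1) := by ring

/-- `1 ≤ Z_n(t)^{1/n}` for `t ≥ 0`. [folklore] -/
theorem one_le_weightedCount_rpow {t : ℝ} (ht : 0 ≤ t) (n : ℕ) :
    1 ≤ (weightedCount t n) ^ (1 / (n : ℝ)) :=
  Real.one_le_rpow (one_le_weightedCount ht n) (by positivity)

/-- `Z_n(t)^{1/n} ≤ 4` for `t ∈ [0, 1]`. [folklore] -/
theorem weightedCount_rpow_le_four {t : ℝ} (ht0 : 0 ≤ t) (ht1 : t ≤ 1) (n : ℕ) :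
    (weightedCount t n) ^ (1 / (n : ℝ)) ≤ 4 := by
  rcases Nat.eq_zero_or_pos n with rfl | hn
  · norm_num
  · have hc : (count n : ℝ) ≤ (4 : ℝ) ^ n := by exact_mod_cast count_le_four_pow n
    have hn' : (n : ℝ) ≠ 0 := by positivity
    calc (weightedCount t n) ^ (1 / (n : ℝ)) ≤ ((4 : ℝ) ^ n) ^ (1 / (n : ℝ)) :=
          Real.rpow_le_rpow (weightedCount_nonneg ht0 n)
            ((weightedCount_le_count ht0 ht1 n).trans hc) (by positivity)
      _ = 4 := by
          rw [← Real.rpow_natCast, ← Real.rpow_mul (by norm_num), mul_one_div_cancel hn',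
            Real.rpow_one]

/-- The sequence `Z_n(t)^{1/n}`, `t ∈ [0, 1]`, is bounded above (by `4`) along `atTop`. [folklore] -/
theorem isBoundedUnder_weightedCount_rpow {t : ℝ} (ht0 : 0 ≤ t) (ht1 : t ≤ 1) :
    IsBoundedUnder (· ≤ ·) atTop (fun n : ℕ => (weightedCount t n) ^ (1 / (n : ℝ))) :=
  isBoundedUnder_of ⟨4, fun n => weightedCount_rpow_le_four ht0 ht1 n⟩

/-- The sequence `Z_n(t)^{1/n}`, `t ≥ 0`, is cobounded (bounded below by `1`) along `atTop`.
[folklore] -/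
theorem isCoboundedUnder_weightedCount_rpow {t : ℝ} (ht : 0 ≤ t) :
    IsCoboundedUnder (· ≤ ·) atTop (fun n : ℕ => (weightedCount t n) ^ (1 / (n : ℝ))) :=
  isCoboundedUnder_le_of_le atTop fun n => one_le_weightedCount_rpow ht n

/-- `1 ≤ limsup Z_n(t)^{1/n} ≤ 4` for `t ∈ [0, 1]`. [folklore] -/
theorem limsup_weightedCount_rpow_mem_Icc {t : ℝ} (ht0 : 0 ≤ t) (ht1 : t ≤ 1) :
    limsup (fun n : ℕ => (weightedCount t n) ^ (1 / (n : ℝ))) atTop ∈ Set.Icc (1 : ℝ) 4 :=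
  ⟨le_limsup_of_frequently_le (Frequently.of_forall fun n => one_le_weightedCount_rpow ht0 n)
      (isBoundedUnder_weightedCount_rpow ht0 ht1),
    limsup_le_of_le (isCoboundedUnder_weightedCount_rpow ht0)
      (Eventually.of_forall fun n => weightedCount_rpow_le_four ht0 ht1 n)⟩

/-- **`x_c(1) = x_c`**: at `t = 1` the weighted counts are the SAW counts `cₙ`, whose `n`-th
roots converge to `μ` (`tendsto_count_rpow_holds`), so the `limsup` is `μ` and
`x_c(1) = μ⁻¹ = criticalFugacity`. [folklore] -/
theorem criticalFugacityT_one : criticalFugacityT 1 = criticalFugacity := by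
  rw [criticalFugacityT, criticalFugacity]
  congr 1
  simp_rw [weightedCount_one]
  exact tendsto_count_rpow_holds.limsup_eq

/-- `x_c(t) ∈ [1/4, 1]` for `t ∈ [0, 1]`. [folklore] -/
theorem criticalFugacityT_mem_Icc {t : ℝ} (ht0 : 0 ≤ t) (ht1 : t ≤ 1) :
    criticalFugacityT t ∈ Set.Icc (4⁻¹ : ℝ) 1 := by
  obtain ⟨h1, h4⟩ := limsup_weightedCount_rpow_mem_Icc ht0 ht1
  exact ⟨inv_anti₀ (by linarith) h4, inv_le_one_of_one_le₀ h1⟩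

/-- `x_c(t) > 0` for `t ∈ [0, 1]`. [folklore] -/
theorem criticalFugacityT_pos {t : ℝ} (ht0 : 0 ≤ t) (ht1 : t ≤ 1) : 0 < criticalFugacityT t :=
  lt_of_lt_of_le (by norm_num) (criticalFugacityT_mem_Icc ht0 ht1).1

/-- `x_c` is non-increasing in `t ∈ [0, 1]` (more weight, faster growth); in particular
`x_c = x_c(1) ≤ x_c(t) ≤ x_c(0)`. [folklore] -/
theorem criticalFugacityT_antitoneOn : AntitoneOn criticalFugacityT (Set.Icc 0 1) := by
  intro s hs t ht hst
  have hpos : 0 < limsup (fun n : ℕ => (weightedCount s n) ^ (1 / (n : ℝ))) atTop :=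
    lt_of_lt_of_le one_pos (limsup_weightedCount_rpow_mem_Icc hs.1 hs.2).1
  refine inv_anti₀ hpos (limsup_le_limsup (Eventually.of_forall fun n => ?_)
    (isCoboundedUnder_weightedCount_rpow hs.1) (isBoundedUnder_weightedCount_rpow ht.1 ht.2))
  exact Real.rpow_le_rpow (weightedCount_nonneg hs.1 n) (weightedCount_mono hs.1 hst n)
    (by positivity)

end Counts

/-! ### The brick-wall weight and law on SAWs of a discrete domain -/

/-- The **`t`-weighted critical SAW measure** on SAWs of `Ω_δ ⊆ δℤ²` from `a` to `b`: the walk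
`γ` gets mass `x_c(t)^{|γ|} · t^{N_odd(γ)}` (at `t = 1` this is `weight Ω δ a b`,
`brickWallWeight_one`). A sum of weighted Dirac masses, as `weight`. [folklore] -/
def brickWallWeight (Ω : Set ℂ) (δ t : ℝ) (a b : Site 2) : Measure (DomainSAW Ω δ a b) :=
  Measure.sum (fun γ : DomainSAW Ω δ a b =>
    ENNReal.ofReal (criticalFugacityT t ^ γ.length * t ^ (oddVerticalCount γ.walk)) •
      Measure.dirac γ)

/-- **`brickWallLaw Ω δ t a b = P^t_{(Ω,δ)}`**, the law of the `t`-weighted critical SAW from `a`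
to `b` in `Ω_δ`: `P^t(γ) ∝ x_c(t)^{|γ|} t^{N_odd(γ)}`, i.e. `brickWallWeight` normalised by its
total mass. Junk value `0` when no SAW from `a` to `b` has positive weight (or if the total
weight were infinite — impossible for bounded `Ω`, `δ > 0`). At `t = 1` it is `law Ω δ a b`
(`brickWallLaw_one`). Literally the term `P` of route item `BrickWallFlow`. [folklore] -/
def brickWallLaw (Ω : Set ℂ) (δ t : ℝ) (a b : Site 2) : Measure (DomainSAW Ω δ a b) :=
  (brickWallWeight Ω δ t a b Set.univ)⁻¹ • brickWallWeight Ω δ t a b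

section Law

variable {Ω : Set ℂ} {δ t : ℝ} {a b : Site 2}

/-- The value of `brickWallWeight` on a set: the sum of the weights of its elements. [folklore] -/
theorem brickWallWeight_apply (Ω : Set ℂ) (δ t : ℝ) (a b : Site 2) (s : Set (DomainSAW Ω δ a b)) :
    brickWallWeight Ω δ t a b s = ∑' γ : DomainSAW Ω δ a b,
      s.indicator (fun γ => ENNReal.ofReal
        (criticalFugacityT t ^ γ.length * t ^ (oddVerticalCount γ.walk))) γ := by
  rw [brickWallWeight, Measure.sum_apply _ MeasurableSpace.measurableSet_top]
  refine tsum_congr fun γ => ?_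
  rw [Measure.smul_apply, Measure.dirac_apply' _ MeasurableSpace.measurableSet_top, smul_eq_mul]
  by_cases hγ : γ ∈ s <;> simp [hγ]

/-- The weight of a single SAW is `x_c(t)^{|γ|} t^{N_odd(γ)}`. [folklore] -/
theorem brickWallWeight_singleton (γ : DomainSAW Ω δ a b) :
    brickWallWeight Ω δ t a b {γ} =
      ENNReal.ofReal (criticalFugacityT t ^ γ.length * t ^ (oddVerticalCount γ.walk)) := by
  rw [brickWallWeight_apply, tsum_eq_single γ]
  · simp
  · intro γ' hγ'
    simp [hγ']

/-- The total weight is the sum of all weights. [folklore] -/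
theorem brickWallWeight_univ (Ω : Set ℂ) (δ t : ℝ) (a b : Site 2) :
    brickWallWeight Ω δ t a b Set.univ = ∑' γ : DomainSAW Ω δ a b,
      ENNReal.ofReal (criticalFugacityT t ^ γ.length * t ^ (oddVerticalCount γ.walk)) := by
  rw [brickWallWeight_apply]
  simp

/-- **At `t = 1` the brick-wall weight is the critical SAW weight `x_c^{|γ|}`.** [folklore] -/
theorem brickWallWeight_one (Ω : Set ℂ) (δ : ℝ) (a b : Site 2) :
    brickWallWeight Ω δ 1 a b = weight Ω δ a b := by
  simp only [brickWallWeight, weight, criticalFugacityT_one, one_pow, mul_one]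

/-- **At `t = 1` the brick-wall law is the critical SAW law `SAW.law`.** [folklore] -/
theorem brickWallLaw_one (Ω : Set ℂ) (δ : ℝ) (a b : Site 2) :
    brickWallLaw Ω δ 1 a b = law Ω δ a b := by
  rw [brickWallLaw, law, brickWallWeight_one]

/-- `P^t` is a probability measure as soon as the total weight is neither `0` nor `∞`. [folklore] -/
theorem isProbabilityMeasure_brickWallLaw (h0 : brickWallWeight Ω δ t a b Set.univ ≠ 0)
    (hfin : brickWallWeight Ω δ t a b Set.univ ≠ ∞) :
    IsProbabilityMeasure (brickWallLaw Ω δ t a b) :=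
  ⟨by rw [brickWallLaw, Measure.smul_apply, smul_eq_mul, ENNReal.inv_mul_cancel h0 hfin]⟩

/-- Otherwise (`Z = 0` or `Z = ∞`) the law is the junk value `0`. [folklore] -/
theorem brickWallLaw_eq_zero (h : brickWallWeight Ω δ t a b Set.univ = 0 ∨
    brickWallWeight Ω δ t a b Set.univ = ∞) : brickWallLaw Ω δ t a b = 0 := by
  rcases h with h | h
  · rw [brickWallLaw, ← Measure.measure_univ_eq_zero, Measure.smul_apply, h, smul_zero]
  · rw [brickWallLaw, h, ENNReal.inv_top, zero_smul]

/-- Weight positivity: for `t > 0` and `x_c(t) > 0` (automatic for `t ≤ 1`,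
`criticalFugacityT_pos`) every SAW has positive weight. [folklore] -/
theorem brickWallWeight_singleton_pos (ht : 0 < t) (hx : 0 < criticalFugacityT t)
    (γ : DomainSAW Ω δ a b) : 0 < brickWallWeight Ω δ t a b {γ} := by
  rw [brickWallWeight_singleton, ENNReal.ofReal_pos]
  positivity

/-- Hence the total weight is nonzero as soon as some SAW from `a` to `b` exists. [folklore] -/
theorem brickWallWeight_univ_ne_zero [Nonempty (DomainSAW Ω δ a b)] (ht : 0 < t)
    (hx : 0 < criticalFugacityT t) : brickWallWeight Ω δ t a b Set.univ ≠ 0 := by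
  obtain ⟨γ⟩ := ‹Nonempty (DomainSAW Ω δ a b)›
  exact (lt_of_lt_of_le (brickWallWeight_singleton_pos ht hx γ)
    (measure_mono (Set.subset_univ _))).ne'

/-- The total weight is finite when there are finitely many SAWs from `a` to `b` (always the case
for bounded `Ω` and `δ > 0`). [folklore] -/
theorem brickWallWeight_univ_lt_top [Finite (DomainSAW Ω δ a b)] :
    brickWallWeight Ω δ t a b Set.univ < ∞ := by
  have := Fintype.ofFinite (DomainSAW Ω δ a b)
  rw [brickWallWeight_univ, tsum_fintype]
  exact ENNReal.sum_lt_top.2 fun _ _ => ENNReal.ofReal_lt_top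

/-- **`P^t` is a probability measure** when finitely many SAWs from `a` to `b` exist, at least
one does, `t > 0` and `x_c(t) > 0`. [folklore] -/
theorem isProbabilityMeasure_brickWallLaw_of_finite [Finite (DomainSAW Ω δ a b)]
    [Nonempty (DomainSAW Ω δ a b)] (ht : 0 < t) (hx : 0 < criticalFugacityT t) :
    IsProbabilityMeasure (brickWallLaw Ω δ t a b) :=
  isProbabilityMeasure_brickWallLaw (brickWallWeight_univ_ne_zero ht hx)
    brickWallWeight_univ_lt_top.ne

/-- The law of a single SAW: `P^t(γ) = x_c(t)^{|γ|} t^{N_odd(γ)} / Z`. [folklore] -/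
theorem brickWallLaw_singleton (γ : DomainSAW Ω δ a b) :
    brickWallLaw Ω δ t a b {γ} = (brickWallWeight Ω δ t a b Set.univ)⁻¹ *
      ENNReal.ofReal (criticalFugacityT t ^ γ.length * t ^ (oddVerticalCount γ.walk)) := by
  rw [brickWallLaw, Measure.smul_apply, smul_eq_mul, brickWallWeight_singleton]

/-- Every observable of the SAW is measurable for `P^t` (discrete σ-algebra). [folklore] -/
theorem aemeasurable_brickWallLaw {β : Type*} [MeasurableSpace β] (f : DomainSAW Ω δ a b → β) :
    AEMeasurable f (brickWallLaw Ω δ t a b) :=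
  (DomainSAW.measurable_of_top f).aemeasurable

end Law

end Literature.Probability.RandomPlanarGeometry.SAW
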